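import Mathlib
import Literature.Probability.LatticeModels.GKSInequalities
import Summits.CriticalPhenomena.Ising3DConformalLimit.Theses.PrecisionLaplacian
import Summits.CriticalPhenomena.Ising3DConformalLimit.Theorems.PrecisionLaplacianInverseMFerromagnetImOfSp
import Summits.CriticalPhenomena.Ising3DConformalLimit.Theorems.PrecisionLaplacianInverseMFerromagnetRowDegLeTwo
import HarnessLib

/-!
# Crux `PrecisionLaplacian.InverseMFerromagnet` (stmt-CriticalPhenomena-4798), line `Sketch` —
# stub `stub_im_of_rowTransfer` (core F, F3: IM from the row transfer, by induction on the nonzero bonds)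

THEOREM-ONLY file (no definitions).  The crux IM says that every off-diagonal entry of the inverse
spin second-moment matrix `Σ⁻¹` of a finite zero-field pair ferromagnet (`gksExpect univ K C`,
`K ≥ 0`, `|C i| = 2`) is `≤ 0`.  This file proves the induction F3 of core F from the ROW TRANSFER
(F2, a hypothesis here): for a support `{p,v}`, if row `p` of the precision matrix of the system with
the couplings on `{p,v}` ZEROED is `≤ 0` off the diagonal, then row `p` of the precision matrix of the
full system is `≤ 0` at every `y ∉ {p,v}`.

PROOF.  Fix `n, m`; strong induction on the number of nonzero couplings (as in `stub_im_of_sp`).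
For a pair `x ≠ y`:
* either some bond `C i₀ = {x,v}` with `K i₀ ≠ 0` has `C i₀ ≠ {x,y}` (so `v ≠ x`, `v ≠ y`): the deleted
  coupling vector `K⁰ i = if C i = {x,v} then 0 else K i` is nonnegative (`csp_nonneg_delete`) and has
  fewer nonzero entries (`csp_card_filter_lt`), so by induction the whole row `x` of its precision
  matrix is `≤ 0` off the diagonal, and the row transfer gives `(Σ⁻¹)_xy ≤ 0`;
* or every nonzero bond at `x` has support `{x,y}` (`x` is PENDANT to `y`, or isolated; this covers the
  base of the induction): integrating out `σ_x` (`c3_gksExpect_spin_eq_tanh`) gives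
  `Σ_xq = t Σ_yq` for all `q ≠ x` with `t = tanh(∑_{i : x ∈ C i} K i) ≥ 0` (zero couplings do not
  contribute to the local field whatever their support), hence `e_x − t e_y = c (Σ⁻¹)_{x,·}` with
  `c (Σ⁻¹)_xx = 1`, `c > 0` (`Σ⁻¹` is positive definite), and `(Σ⁻¹)_xy = −t/c ≤ 0`
  (`irt_inv_entry_nonpos_of_row`, the linear algebra of `stub_row_deg_le_two`).
-/

namespace Summit.CriticalPhenomena.Ising3DConformalLimit.Cruxes.InverseMFerromagnet.PartialCovarianceLadder

open Literature.Probability.LatticeModels Finset Matrix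
open Summit.CriticalPhenomena.Ising3DConformalLimit.Theses.PrecisionLaplacian (InverseMFerromagnet)

noncomputable section

/-- A member `x` of a two-element finset `s` determines its partner: `s = {x, v}` with `v ≠ x`.
[folklore] -/
theorem irt_pair_of_mem {n : ℕ} {s : Finset (Fin n)} {x : Fin n} (hx : x ∈ s) (hs : s.card = 2) :
    ∃ v : Fin n, v ≠ x ∧ s = {x, v} := by
  -- adapted from Theorems/PrecisionLaplacianInverseMFerromagnetRowDegLeTwo.lean (`stub_row_deg_le_two`)
  have h1 : (s.erase x).card = 1 := by rw [Finset.card_erase_of_mem hx, hs]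
  obtain ⟨a, ha⟩ := Finset.card_eq_one.1 h1
  have hax : a ∈ s.erase x := by rw [ha]; exact Finset.mem_singleton_self a
  exact ⟨a, (Finset.mem_erase.1 hax).1, by rw [← Finset.insert_erase hx, ha]⟩

/-- **Linear algebra of a proportional row.**  If `A` is positive definite and `A x q = t · A y q` for
all `q ≠ x` (`x ≠ y`, `t ≥ 0`), then `A⁻¹ x y ≤ 0`: the vector `w = e_x − t e_y` has `(wᵀA)_q = 0` for
`q ≠ x`, so `wᵀ = c (A⁻¹)_{x,·}` with `c (A⁻¹)_xx = w_x = 1`, `c > 0`, and `c (A⁻¹)_xy = w_y = −t`.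
[folklore] -/
theorem irt_inv_entry_nonpos_of_row {n : ℕ} (A : Matrix (Fin n) (Fin n) ℝ) (hPD : A.PosDef)
    (x y : Fin n) (hxy : x ≠ y) (t : ℝ) (ht : 0 ≤ t) (hkey : ∀ q, q ≠ x → A x q = t * A y q) :
    A⁻¹ x y ≤ 0 := by
  -- adapted from Theorems/PrecisionLaplacianInverseMFerromagnetRowDegLeTwo.lean (`stub_row_deg_le_two`)
  have hdet : IsUnit A.det := (Matrix.isUnit_iff_isUnit_det A).mp hPD.isUnit
  obtain ⟨w, hw⟩ : ∃ w : Fin n → ℝ,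
      ∀ p, w p = (if p = x then (1 : ℝ) else 0) - (if p = y then t else 0) := ⟨_, fun _ => rfl⟩
  have hwsum : ∀ f : Fin n → ℝ, ∑ p, w p * f p = f x - t * f y := by
    intro f
    have h1 : ∀ p, w p * f p = (if p = x then f p else 0) - (if p = y then t * f p else 0) := by
      intro p
      rw [hw, sub_mul]
      congr 1 <;> split_ifs <;> simp
    simp_rw [h1]
    rw [Finset.sum_sub_distrib, Finset.sum_ite_eq', Finset.sum_ite_eq']
    simp
  have hwA : ∀ q, q ≠ x → (w ᵥ* A) q = 0 := by
    intro q hq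
    simp only [Matrix.vecMul, dotProduct]
    rw [hwsum (fun p => A p q), hkey q hq, sub_self]
  obtain ⟨cz, hcz⟩ : ∃ cz : ℝ, cz = (w ᵥ* A) x := ⟨_, rfl⟩
  have hvec : w ᵥ* A = Pi.single x cz := by
    funext q
    by_cases hq : q = x
    · rw [hq, Pi.single_eq_same, hcz]
    · rw [Pi.single_eq_of_ne hq, hwA q hq]
  have hwq : ∀ q, w q = cz * A⁻¹ x q := by
    have h : w = cz • A⁻¹ x := by
      calc w = (w ᵥ* A) ᵥ* A⁻¹ := by
            rw [Matrix.vecMul_vecMul, Matrix.mul_nonsing_inv A hdet, Matrix.vecMul_one]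
        _ = cz • A⁻¹ x := by rw [hvec, Matrix.single_vecMul]; rfl
    intro q
    have hq' := congrFun h q
    simpa only [Pi.smul_apply, smul_eq_mul] using hq'
  have hwx : w x = 1 := by
    rw [hw, if_pos rfl, if_neg hxy, sub_zero]
  have hwy : w y = -t := by
    rw [hw, if_neg (Ne.symm hxy), if_pos rfl, zero_sub]
  have hcz_pos : 0 < cz := by
    have h1 : 0 < cz * A⁻¹ x x := by rw [← hwq x, hwx]; exact one_pos
    exact pos_of_mul_pos_left h1 hPD.inv.diag_pos.le
  have hy := hwq y
  rw [hwy] at hy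
  rcases lt_or_ge 0 (A⁻¹ x y) with hpos | hle
  · have h2 : 0 < cz * A⁻¹ x y := mul_pos hcz_pos hpos
    linarith
  · exact hle

/-- **The pendant case.**  If every bond with a nonzero coupling containing `x` has support `{x,y}`,
then `(Σ⁻¹)_xy ≤ 0`: integrating out `σ_x` gives `Σ_xq = tanh(κ) Σ_yq` for `q ≠ x`, where
`κ = ∑_{i : x ∈ C i} K i ≥ 0` (a bond `{x,u}` with `K i = 0` contributes nothing to the local field at
`x`), and `irt_inv_entry_nonpos_of_row` applies. [folklore] -/
theorem irt_pendant {n m : ℕ} (K : Fin m → ℝ) (C : Fin m → Finset (Fin n)) (hK : ∀ i, 0 ≤ K i)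
    (hC : ∀ i, (C i).card = 2) (x y : Fin n) (hxy : x ≠ y)
    (hpend : ∀ i, K i ≠ 0 → x ∈ C i → C i = {x, y}) :
    (Matrix.of fun p q : Fin n =>
      gksExpect Finset.univ K C (fun ω => spinAt p ω * spinAt q ω))⁻¹ x y ≤ 0 := by
  -- the partner `u i` of `x` in each bond `C i ∋ x`
  have hex : ∀ i : Fin m, ∃ a : Fin n, a ≠ x ∧ (x ∈ C i → C i = {x, a}) := by
    intro i
    by_cases hx : x ∈ C i
    · obtain ⟨a, hax, ha⟩ := irt_pair_of_mem hx (hC i)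
      exact ⟨a, hax, fun _ => ha⟩
    · exact ⟨y, hxy.symm, fun h => absurd h hx⟩
  choose u hux hu using hex
  set I : Finset (Fin m) := Finset.univ.filter (fun i => x ∈ C i) with hIdef
  have hI : ∀ i, i ∈ I ↔ x ∈ C i := fun i => by simp [hIdef]
  obtain ⟨φ, hφ⟩ : ∃ φ : SpinConfig (Fin n) → SpinConfig (Fin n),
      ∀ ω p, φ ω p = if p = x then -ω p else ω p :=
    ⟨fun ω p => if p = x then -ω p else ω p, fun _ _ => rfl⟩
  -- on `I`, `K i σ_{u i} = K i σ_y`: either `K i = 0` or `C i = {x, y}` forces `u i = y`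
  have hKu : ∀ i ∈ I, ∀ ω : SpinConfig (Fin n), K i * spinAt (u i) ω = K i * spinAt y ω := by
    intro i hi ω
    by_cases hKi : K i = 0
    · rw [hKi, zero_mul, zero_mul]
    · have hxi : x ∈ C i := (hI i).1 hi
      have hmem : u i ∈ ({x, y} : Finset (Fin n)) := by
        rw [← hpend i hKi hxi, hu i hxi]
        exact Finset.mem_insert_of_mem (Finset.mem_singleton_self _)
      rcases Finset.mem_insert.1 hmem with h | h
      · exact absurd h (hux i)
      · rw [Finset.mem_singleton.1 h]
  set t : ℝ := Real.tanh (∑ i ∈ I, K i) with htdef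
  have ht : 0 ≤ t := by
    rw [htdef, Real.tanh_eq_sinh_div_cosh]
    exact div_nonneg (Real.sinh_nonneg_iff.2 (Finset.sum_nonneg fun i _ => hK i)) (Real.cosh_pos _).le
  have hT : ∀ ω : SpinConfig (Fin n),
      Real.tanh (∑ i ∈ I, K i * spinAt (u i) ω) = t * spinAt y ω := by
    intro ω
    rw [Finset.sum_congr rfl (fun i hi => hKu i hi ω), ← Finset.sum_mul, htdef]
    rcases spinAt_eq_one_or_eq_neg_one y ω with h | h <;> rw [h]
    · rw [mul_one, mul_one]
    · rw [mul_neg_one, mul_neg_one, Real.tanh_neg]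
  set A : Matrix (Fin n) (Fin n) ℝ :=
    Matrix.of (fun p q : Fin n => gksExpect Finset.univ K C (fun ω => spinAt p ω * spinAt q ω))
    with hA
  -- `Σ_xq = t Σ_yq` for `q ≠ x`
  have hkey : ∀ q, q ≠ x → A x q = t * A y q := by
    intro q hq
    have h1 := c3_gksExpect_spin_eq_tanh K C x φ hφ I hI u hu hux (spinAt q)
      (fun ω => by rw [c3_spinAt_flip x φ hφ, if_neg hq])
    have h2 : (fun ω => Real.tanh (∑ i ∈ I, K i * spinAt (u i) ω) * spinAt q ω)
        = fun ω => t * (spinAt y ω * spinAt q ω) := by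
      funext ω
      rw [hT ω, mul_assoc]
    have h3 : gksExpect Finset.univ K C (fun ω => t * (spinAt y ω * spinAt q ω))
        = t * gksExpect Finset.univ K C (fun ω => spinAt y ω * spinAt q ω) := by
      unfold gksExpect
      rw [gksSum_smul, mul_div_assoc]
    rw [h2, h3] at h1
    simpa only [hA, Matrix.of_apply] using h1
  exact irt_inv_entry_nonpos_of_row A (c3_posDef Finset.univ K C) x y hxy t ht hkey

/-- **F3 · `stub_im_of_rowTransfer` — the induction on nonzero bonds.**  From the row transfer F2 (as a
hypothesis): to sign `(Σ⁻¹)_{xy}` delete a nonzero bond at `x` whose support is not `{x,y}` — by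
induction the whole row `x` of the deleted system's precision matrix is `≤ 0` off the diagonal — and
transfer; if every nonzero bond at `x` has support `{x,y}` the entry is `≤ 0` by the pendant computation
`irt_pendant`. [folklore] -/
theorem stub_im_of_rowTransfer :
    (∀ (n m : ℕ) (K : Fin m → ℝ) (C : Fin m → Finset (Fin n)), (∀ i, 0 ≤ K i) → (∀ i, (C i).card = 2) →
      ∀ (p v : Fin n), p ≠ v →
        (∀ w : Fin n, w ≠ p →
          (Matrix.of fun a b : Fin n =>
              gksExpect Finset.univ (fun i => if C i = {p, v} then 0 else K i) C
                (fun ω => spinAt a ω * spinAt b ω))⁻¹ p w ≤ 0) →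
        ∀ y : Fin n, y ≠ p → y ≠ v →
          (Matrix.of fun a b : Fin n => gksExpect Finset.univ K C (fun ω => spinAt a ω * spinAt b ω))⁻¹ p y ≤ 0) →
    InverseMFerromagnet := by
  intro hRT n m
  -- Induction on an upper bound `k` for the number of nonzero couplings, with `n, m` fixed.
  suffices haux : ∀ (k : ℕ) (K : Fin m → ℝ) (C : Fin m → Finset (Fin n)),
      (Finset.univ.filter (fun i => K i ≠ 0)).card ≤ k → (∀ i, 0 ≤ K i) → (∀ i, (C i).card = 2) →
      ∀ x y : Fin n, x ≠ y →
        (Matrix.of fun p q : Fin n =>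
          gksExpect Finset.univ K C (fun ω => spinAt p ω * spinAt q ω))⁻¹ x y ≤ 0 by
    intro K C hK hC x y hxy
    exact haux _ K C le_rfl hK hC x y hxy
  intro k
  induction k with
  | zero =>
    -- no nonzero coupling at all: the pendant hypothesis holds vacuously
    intro K C hk hK hC x y hxy
    refine irt_pendant K C hK hC x y hxy fun i hi _ => ?_
    exfalso
    have hmem : i ∈ Finset.univ.filter (fun i => K i ≠ 0) :=
      Finset.mem_filter.mpr ⟨Finset.mem_univ _, hi⟩
    rw [Finset.card_eq_zero.mp (Nat.le_zero.mp hk)] at hmem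
    exact Finset.notMem_empty _ hmem
  | succ k ih =>
    intro K C hk hK hC x y hxy
    by_cases hpend : ∀ i, K i ≠ 0 → x ∈ C i → C i = {x, y}
    · exact irt_pendant K C hK hC x y hxy hpend
    -- a bond `C i₀ = {x, v}` with nonzero coupling and `v ≠ y`
    push Not at hpend
    obtain ⟨i₀, hKi₀, hxi₀, hCi₀⟩ := hpend
    obtain ⟨v, hvx, hCv⟩ := irt_pair_of_mem hxi₀ (hC i₀)
    have hyv : y ≠ v := fun h => hCi₀ (by rw [hCv, h])
    -- the deleted coupling vector has at most `k` nonzero entries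
    have hle : (Finset.univ.filter
        (fun i => (if C i = {x, v} then (0 : ℝ) else K i) ≠ 0)).card ≤ k :=
      Nat.le_of_lt_succ ((csp_card_filter_lt K C x v i₀ hKi₀ hCv).trans_le hk)
    refine hRT n m K C hK hC x v hvx.symm ?_ y hxy.symm hyv
    intro w hw
    exact ih (fun i => if C i = {x, v} then 0 else K i) C hle (csp_nonneg_delete K C x v hK) hC
      x w (Ne.symm hw)

end

end Summit.CriticalPhenomena.Ising3DConformalLimit.Cruxes.InverseMFerromagnet.PartialCovarianceLadder
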